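import Literature.AnabelianGeometry.SemiGraphs.TemperedFixedSystemsOfUniformEstrangement
import HarnessLib

/-!
# [SemiAnbd] Thm 3.7 (iii) over ANY level data modulo uniform level-estrangement (B1 closer)

Mochizuki, *Semi-graphs of anabelioids*, Publ. RIMS **42** (2006), §3, Theorem 3.7 (iii), manuscript
pp. 40–41 [cite: MochizukiSemiAnbd2006, Thm 3.7(iii) pp.40-41].  PROOF-ONLY sequel (cell abc-iut, layer L3,
GAP row G-t6g3-2b «characterisation half», seat abc-iut-w6-d088; no definition): the composite of
`VerticialLevelData.hfix_of_uniformlyEstranged` / `hadj_of_uniformlyEstranged`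
(`TemperedFixedSystemsOfUniformEstrangement.lean`) with abc-iut-L3-t10's B1
`VerticialLevelData.compactInVerticial_of_fixedSystems` (p427835) over an ARBITRARY `VerticialLevelData`
of an arbitrary chart — the body of `CompactInVerticial` at `(𝒢, c)` for every compact `C`, from the
uniform level-estrangement binder (UE_C) for every compact `C ≠ ⊥` (the sibling file closes the At-form at
the canonical tower through B2).  (UE_C) holds at finite `𝔾`; it fails at the sliding-ray countermodels
(kernel: `ProfiniteSemiGraph.not_compactInVerticial`, abc-iut-L3-d4, `ThetaRayRefutation.lean`).  Nothing
here bears on [IUTchIII] Cor. 3.12.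
-/

namespace Literature.AnabelianGeometry.SemiGraphs

namespace ProfiniteSemiGraph

namespace VerticialLevelData

open CategoryTheory

universe v u

variable {𝒢 : ProfiniteSemiGraph.{u}} {c : TemperedPiChart 𝒢} (D : VerticialLevelData.{v} 𝒢 c)

/-- **Thm. 3.7 (iii) at any Thm-3.7 `𝒢` (finite or not), any chart and any level data, modulo uniform
level-estrangement of the nontrivial compact subgroups** (∘ B1 `compactInVerticial_of_fixedSystems`).
[cite: MochizukiSemiAnbd2006, Thm 3.7(iii) pp.40-41] -/
theorem compactInVerticial_of_uniformlyEstranged (hVD : VerticialDistinct.{u}) (h𝒢 : 𝒢.Thm37Hypotheses)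
    (hex : ∀ v : 𝒢.graph.Vertex, (verticialSubgroups c v).Nonempty)
    (hUE : ∀ C : Subgroup c.G, IsCompact (C : Set c.G) → C ≠ ⊥ → ∀ j : D.J, ∃ (k : D.J) (hjk : j ≤ k),
      ∀ (v : (D.tree k).Vertex) (b b' : (D.tree k).Branch), (D.tree k).abuts b = some v →
      (D.tree k).abuts b' = some v → (D.tree k).edgeOf b ≠ (D.tree k).edgeOf b' →
      (∀ g ∈ C, (D.act k g).hom.edgeMap ((D.tree k).edgeOf b) = (D.tree k).edgeOf b) →
      (∀ g ∈ C, (D.act k g).hom.edgeMap ((D.tree k).edgeOf b') = (D.tree k).edgeOf b') →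
      (D.trans hjk).edgeMap ((D.tree k).edgeOf b) = (D.trans hjk).edgeMap ((D.tree k).edgeOf b'))
    (C : Subgroup c.G) (hC : IsCompact (C : Set c.G)) :
    (∃ (v : 𝒢.graph.Vertex) (H : Subgroup c.G), H ∈ verticialSubgroups c v ∧ C ≤ H) ∧
      (C ≠ ⊥ → ∀ (v₁ v₂ : 𝒢.graph.Vertex) (H₁ H₂ : Subgroup c.G), H₁ ∈ verticialSubgroups c v₁ →
        H₂ ∈ verticialSubgroups c v₂ → H₁ ≠ H₂ → C ≤ H₁ → C ≤ H₂ →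
          (∀ (v₃ : 𝒢.graph.Vertex) (H₃ : Subgroup c.G), H₃ ∈ verticialSubgroups c v₃ → C ≤ H₃ →
              H₃ = H₁ ∨ H₃ = H₂) ∧
          ∃ (e : 𝒢.graph.Edge) (L : Subgroup c.G), 𝒢.graph.IsClosedEdge e ∧
            L ∈ edgeLikeSubgroups c e ∧ C ≤ L) :=
  D.compactInVerticial_of_fixedSystems hVD h𝒢 hex
    (fun C hC hne => D.hfix_of_uniformlyEstranged C hC (hUE C hC hne))
    (fun C hC hne => D.hadj_of_uniformlyEstranged C (hUE C hC hne)) C hC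

/-- The same with the verticial inputs discharged BY NAME (`verticialDistinct_holds`,
`verticialInjective_holds`): Thm. 3.7 (iii) at `(𝒢, c, D)` from `Thm37Hypotheses` and (UE_C) alone.
[cite: MochizukiSemiAnbd2006, Thm 3.7(iii) pp.40-41] -/
theorem compactInVerticial_of_uniformlyEstranged' (h𝒢 : 𝒢.Thm37Hypotheses)
    (hUE : ∀ C : Subgroup c.G, IsCompact (C : Set c.G) → C ≠ ⊥ → ∀ j : D.J, ∃ (k : D.J) (hjk : j ≤ k),
      ∀ (v : (D.tree k).Vertex) (b b' : (D.tree k).Branch), (D.tree k).abuts b = some v →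
      (D.tree k).abuts b' = some v → (D.tree k).edgeOf b ≠ (D.tree k).edgeOf b' →
      (∀ g ∈ C, (D.act k g).hom.edgeMap ((D.tree k).edgeOf b) = (D.tree k).edgeOf b) →
      (∀ g ∈ C, (D.act k g).hom.edgeMap ((D.tree k).edgeOf b') = (D.tree k).edgeOf b') →
      (D.trans hjk).edgeMap ((D.tree k).edgeOf b) = (D.trans hjk).edgeMap ((D.tree k).edgeOf b'))
    (C : Subgroup c.G) (hC : IsCompact (C : Set c.G)) :
    (∃ (v : 𝒢.graph.Vertex) (H : Subgroup c.G), H ∈ verticialSubgroups c v ∧ C ≤ H) ∧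
      (C ≠ ⊥ → ∀ (v₁ v₂ : 𝒢.graph.Vertex) (H₁ H₂ : Subgroup c.G), H₁ ∈ verticialSubgroups c v₁ →
        H₂ ∈ verticialSubgroups c v₂ → H₁ ≠ H₂ → C ≤ H₁ → C ≤ H₂ →
          (∀ (v₃ : 𝒢.graph.Vertex) (H₃ : Subgroup c.G), H₃ ∈ verticialSubgroups c v₃ → C ≤ H₃ →
              H₃ = H₁ ∨ H₃ = H₂) ∧
          ∃ (e : 𝒢.graph.Edge) (L : Subgroup c.G), 𝒢.graph.IsClosedEdge e ∧
            L ∈ edgeLikeSubgroups c e ∧ C ≤ L) :=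
  D.compactInVerticial_of_uniformlyEstranged verticialDistinct_holds h𝒢
    (fun v => (verticialInjective_holds 𝒢 h𝒢 c v).1) hUE C hC

end VerticialLevelData

end ProfiniteSemiGraph

end Literature.AnabelianGeometry.SemiGraphs
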